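import Literature.NumberTheory.EllipticCurves.EisensteinNewformLevelRaisingOrdinaryUnitRootSpecializationProofs
import Literature.NumberTheory.GaloisRepresentations.StableLatticeValuationRing
import Literature.NumberTheory.GaloisRepresentations.GoodDihedralLocalImage
import Literature.NumberTheory.GaloisRepresentations.LocalKroneckerWeberInertiaProofs
import Literature.NumberTheory.GaloisRepresentations.DecompositionGroupOfCompletion
import Literature.NumberTheory.EllipticCurves.NewformsProofs
import Literature.NumberTheory.EllipticCurves.NewformsLiftProofs
import HarnessLib

/-!
# Calibrator supply S2a-NF from three named printed facts — BUILT port of the «F-irr» Sketch, file 1/3: PART A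

PORT RECORD (3 files, ONE namespace `Summit.BirchSwinnertonDyer.BirchSwinnertonDyer.Theorems.ErratumRoadFiveBdvCalibrationSplitNFCalibratorSupply`):
`…CalibratorSupplyFirr` = PART A (A.1–A.3) · `…CalibratorSupplyCM` = PART B–C · `…CalibratorSupply` = PART D–E (module
of record).  1:1 port — every declaration, statement and proof byte-identical, in the Sketch's order — of the Cruxes
workfile `Summits/BirchSwinnertonDyer/BirchSwinnertonDyer/Cruxes/EulerHalfNotRamNoInertSetAtFive/Lines/calibrator_Firr_Sketch.lean` rev 1.2,
**bytes: bsd-idea-9 g55, Cruxes/EulerHalfNotRamNoInertSetAtFive/Lines/calibrator_Firr_Sketch.lean rev 1.2 (c83736268e5f3766)**; deltas: the namespace,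
the Sketch's `set_option linter.dupNamespace false` replaced by the cell's commented D-0017 line, `trace_conj_eq` made
`private`, imports and the Sketch's module docstring distributed over the three files (the tree's 400-line cap:
763 Sketch lines + 3 headers do not fit 2 × 400).  BUILT modules, so that the registry file of item 33169
(`Cruxes/KatoValuationIneqNonsplitAtFive/Lines/bstw_door.lean`) can import them (a Cruxes workfile is not importable).
Ported by the LEAD lineage bsd-line-er5-p1 (g21) on SUMMON key `s2aport` (pen bsd-stepL-plan g53; authority director-bsd
(778) (σ1)); `--supports stmt-BirchSwinnertonDyer-33169`.  HELPER ONLY: closes no registered stub by signature; PART E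
`calibratorSupplyNF_of_printedFacts` makes S2a-NF (`stub_calibratorSupplyNF` of 33169 r3, token for token) a consequence
of THREE NAMED PRINTED FACTS `hW`, `h61`, `hPRE` — a conditional theorem, not a proof of S2a-NF; typed ≠ proved; no
summit statement is proved here; BSD is proved for no curve.

The Sketch's module docstring (title, PART A, remaining hypotheses) follows verbatim; PART B–E paragraphs are in files 2–3.

# Calibrator gap «F-irr» — residual absolute irreducibility of the `p`-ordinary CM calibrator
(Sketch for crux `ErratumRoadFive.EulerHalfNotRamNoInertSetAtFive`, lines `kato_Fframe_r5` /
`bstw_door`; complete-lens target = conjunct `ρ.IsResiduallyAbsIrreducible` of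
`…ErratumRoadFiveBdvCalibrationSplitNF.CalibratorSupplyNF`, typer memo TY-SNF gap #4).

PART A (Hecke-character-free): an irreducible `p`-adic Galois representation
`ρ : Γ_ℚ → GL₂(ℚ̄_p)` attached to a `p`-ordinary newform of weight `2` and level prime to `p`
(`p` odd) whose traces VANISH off a proper subgroup `H ≤ Γ_ℚ` containing the image of the
inertia group at `p` is residually absolutely irreducible.  Mechanism: if some scalar extension
`τ'` of the reduction had a common eigenvector `v`, `τ' v = χ₁ v`, put `χ₂ := tr τ' - χ₁`
(again a character); `χ₁ + χ₂ = tr τ' = 0` off `H`, whence `χ₁(γ) = χ₂(γ)` for `γ ∈ H`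
(translate by one `γ₀ ∉ H`); but Hida's ordinary frame at `p`
(`Hida2000_thm326_ordinary_unitRoot.exists_residualFrame`, GRANTED printed fact) makes
`τ'|_{Γ_{ℚ_p}}` upper triangular with diagonal `(ω·unr, unr)`, `= (ω, 1)` on inertia, and local
Kronecker–Weber supplies `σ ∈ I_p` (so `γ = σ|_ℚ̄ ∈ H`) with `ω(σ) = -1`: `tr τ'(γ) = 0 = 2χ₁(γ)`,
i.e. `2 = 0`, absurd in odd residue characteristic.

Remaining hypotheses: `hW` = GRANTED `Hida2000_thm326_ordinary_unitRoot` (the cell's standard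
printed fact, Hida *MFG* Thm. 3.26 (2)), `h61` = `DeligneSerre1974.thm61_exists_adicGaloisRep`
(Deligne's theorem, Deligne–Serre Thm. 6.1 — a named Literature fact) and, for PART E only, `hPRE`.
No summit statement is proved here; `CalibratorSupplyNF` is proved ONLY conditionally on the three
named facts; BSD is proved for no curve by this file.
-/

-- D-0017: single-problem summit, so `Summit.BirchSwinnertonDyer.BirchSwinnertonDyer.…` repeats a namespace BY DESIGN.
set_option linter.dupNamespace false

namespace Summit.BirchSwinnertonDyer.BirchSwinnertonDyer.Theorems.ErratumRoadFiveBdvCalibrationSplitNFCalibratorSupply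

open scoped MatrixGroups NumberField Matrix
open Literature.NumberTheory.GaloisRepresentations
open Literature.NumberTheory.EllipticCurves
open Literature.NumberTheory.EllipticCurves.ModularForms
open IsDedekindDomain Field

/-! ## A.1  Pure algebra: traces vanishing off a subgroup vs. a trace-zero element inside it -/

section Core

variable {G : Type*} [Group G] {k : Type*} [Field k]

/-- **Core lemma (frame-free).** Let `τ : G → GL₂(k)` have a common eigenvector, let `H ≤ G`
be a proper subgroup with `tr τ(γ) = 0` for every `γ ∉ H`, and let `γ ∈ H` have `tr τ(γ) = 0`.
Then `2 = 0` in `k`.  (With `χ₁` the eigenvalue character on the common eigenvector and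
`χ₂ := tr τ - χ₁` the other diagonal character: `χ₂(γ₀) = -χ₁(γ₀)` and
`χ₁(γ₀)χ₁(γ) + χ₂(γ₀)χ₂(γ) = 0` give `χ₁(γ) = χ₂(γ)`, so `0 = tr τ(γ) = 2χ₁(γ)`.) [folklore] -/
theorem two_eq_zero_of_trace_eq_zero_off_subgroup (τ : G →* GL (Fin 2) k) (H : Subgroup G)
    {γ₀ : G} (hγ₀ : γ₀ ∉ H)
    (htr : ∀ g, g ∉ H → Matrix.trace ((τ g : GL (Fin 2) k) : Matrix (Fin 2) (Fin 2) k) = 0)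
    (hce : HasCommonEigenvector τ) {γ : G} (hγ : γ ∈ H)
    (hγtr : Matrix.trace ((τ γ : GL (Fin 2) k) : Matrix (Fin 2) (Fin 2) k) = 0) :
    (2 : k) = 0 := by
  classical
  obtain ⟨v, hv, key⟩ := hce
  choose a ha using key
  -- notation
  set M : G → Matrix (Fin 2) (Fin 2) k := fun g => ((τ g : GL (Fin 2) k) : Matrix (Fin 2) (Fin 2) k)
    with hMdef
  have haM : ∀ g, M g *ᵥ v = a g • v := fun g => ha g
  -- the eigenvalue character is non-zero and multiplicative
  have ha0 : ∀ g, a g ≠ 0 := by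
    intro g hg
    apply hv
    have h1 : M g *ᵥ v = 0 := by rw [haM g, hg, zero_smul]
    have h2 : (((τ g)⁻¹ : GL (Fin 2) k) : Matrix (Fin 2) (Fin 2) k) *ᵥ (M g *ᵥ v) = v := by
      rw [Matrix.mulVec_mulVec, hMdef]
      dsimp only
      rw [← Matrix.GeneralLinearGroup.coe_mul, inv_mul_cancel, Matrix.GeneralLinearGroup.coe_one,
        Matrix.one_mulVec]
    rw [← h2, h1, Matrix.mulVec_zero]
  have hamul : ∀ g h, a (g * h) = a g * a h := by
    intro g h
    have e : a (g * h) • v = (a g * a h) • v := by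
      rw [← haM, hMdef]
      dsimp only
      rw [map_mul, Matrix.GeneralLinearGroup.coe_mul, ← Matrix.mulVec_mulVec]
      change M g *ᵥ (M h *ᵥ v) = _
      rw [haM h, Matrix.mulVec_smul, haM g, smul_smul, mul_comm]
    exact smul_left_injective k hv e
  -- the eigenvalue is a root of the characteristic polynomial: `a² - tr·a + det = 0`
  have hchar : ∀ g, a g ^ 2 - (M g).trace * a g + (M g).det = 0 := by
    intro g
    have e0 := congr_fun (haM g) 0
    have e1 := congr_fun (haM g) 1
    simp only [Matrix.mulVec, dotProduct, Fin.sum_univ_two, Pi.smul_apply, smul_eq_mul] at e0 e1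
    rw [Matrix.trace_fin_two, Matrix.det_fin_two]
    have hx : v 0 * (a g ^ 2 - ((M g) 0 0 + (M g) 1 1) * a g +
        ((M g) 0 0 * (M g) 1 1 - (M g) 0 1 * (M g) 1 0)) = 0 := by
      linear_combination ((M g) 1 1 - a g) * e0 - (M g) 0 1 * e1
    have hy : v 1 * (a g ^ 2 - ((M g) 0 0 + (M g) 1 1) * a g +
        ((M g) 0 0 * (M g) 1 1 - (M g) 0 1 * (M g) 1 0)) = 0 := by
      linear_combination ((M g) 0 0 - a g) * e1 - (M g) 1 0 * e0
    by_contra hne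
    apply hv
    ext i
    fin_cases i
    · exact (mul_eq_zero.mp hx).resolve_right hne
    · exact (mul_eq_zero.mp hy).resolve_right hne
  -- the complementary character `b := tr - a`, with `a * b = det`, is multiplicative
  set b : G → k := fun g => (M g).trace - a g with hbdef
  have hab : ∀ g, a g * b g = (M g).det := by
    intro g
    have := hchar g
    simp only [hbdef]
    linear_combination -this
  have hdetmul : ∀ g h, (M (g * h)).det = (M g).det * (M h).det := by
    intro g h
    simp only [hMdef, map_mul, Matrix.GeneralLinearGroup.coe_mul, Matrix.det_mul]
  have hbmul : ∀ g h, b (g * h) = b g * b h := by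
    intro g h
    have h1 : a (g * h) * b (g * h) = (a g * b g) * (a h * b h) := by
      rw [hab, hab, hab, hdetmul]
    rw [hamul] at h1
    have h2 : a g * a h * (b (g * h) - b g * b h) = 0 := by linear_combination h1
    rcases mul_eq_zero.mp h2 with h3 | h3
    · rcases mul_eq_zero.mp h3 with h4 | h4
      · exact absurd h4 (ha0 g)
      · exact absurd h4 (ha0 h)
    · exact sub_eq_zero.mp h3
  have htrab : ∀ g, (M g).trace = a g + b g := fun g => by simp only [hbdef]; ring
  -- `a = b` at `γ ∈ H`
  have h1 : a γ₀ + b γ₀ = 0 := by rw [← htrab]; exact htr γ₀ hγ₀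
  have h2 : a (γ₀ * γ) + b (γ₀ * γ) = 0 := by
    rw [← htrab]
    exact htr _ fun hmem => hγ₀ (by simpa using H.mul_mem hmem (H.inv_mem hγ))
  rw [hamul, hbmul] at h2
  have h3 : a γ₀ * (a γ - b γ) = 0 := by linear_combination h2 - b γ * h1
  have h4 : a γ = b γ := by
    rcases mul_eq_zero.mp h3 with h | h
    · exact absurd h (ha0 γ₀)
    · exact sub_eq_zero.mp h
  -- `0 = tr τ(γ) = 2 a(γ)`
  have h5 : (2 : k) * a γ = 0 := by
    have := htrab γ
    rw [hγtr, ← h4, ← two_mul] at this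
    exact this.symm
  rcases mul_eq_zero.mp h5 with h | h
  · exact h
  · exact absurd h (ha0 γ)

/-- Trace is a conjugation invariant in `GL₂(k)` (the form used with residual frames). [folklore] -/
private theorem trace_conj_eq (Q A : GL (Fin 2) k) :
    Matrix.trace ((Q⁻¹ * A * Q : GL (Fin 2) k) : Matrix (Fin 2) (Fin 2) k) =
      Matrix.trace ((A : GL (Fin 2) k) : Matrix (Fin 2) (Fin 2) k) := by
  rw [Matrix.GeneralLinearGroup.coe_mul, Matrix.GeneralLinearGroup.coe_mul, Matrix.trace_mul_cycle,
    ← Matrix.GeneralLinearGroup.coe_mul, mul_inv_cancel, Matrix.GeneralLinearGroup.coe_one,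
    Matrix.one_mul]

end Core

/-! ## A.2  Odd residue characteristic -/

/-- `p` reduces to `0` in the residue field of the valuation ring `ℤ̄_p` of `ℚ̄_p`
(`v(p) = 1/p < 1`, so `p` is a non-unit of `ℤ̄_p`). [folklore] -/
theorem residue_natCast_eq_zero (p : ℕ) [Fact p.Prime] :
    IsLocalRing.residue (padicAlgClIntegers p) (p : padicAlgClIntegers p) = 0 := by
  have hp : (p : ℕ).Prime := Fact.out
  rw [IsLocalRing.residue_eq_zero_iff, IsLocalRing.mem_maximalIdeal, mem_nonunits_iff]
  intro hu
  have hlt : Valued.v ((p : padicAlgClIntegers p) : PadicAlgCl p) < 1 := by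
    rw [show ((p : padicAlgClIntegers p) : PadicAlgCl p) = (p : PadicAlgCl p) from rfl,
      PadicAlgCl.valuation_p]
    have hp1 : (1 : NNReal) < p := by exact_mod_cast hp.one_lt
    rw [one_div]
    exact inv_lt_one_of_one_lt₀ hp1
  -- a unit of `ℤ̄_p` has valuation `1`
  obtain ⟨u, hu'⟩ := hu
  have h1 : Valued.v ((u : padicAlgClIntegers p) : PadicAlgCl p) *
      Valued.v (((u⁻¹ : (padicAlgClIntegers p)ˣ) : padicAlgClIntegers p) : PadicAlgCl p) = 1 := by
    rw [← map_mul, ← Subring.coe_mul]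
    have := congrArg (fun y : padicAlgClIntegers p => Valued.v (y : PadicAlgCl p)) u.mul_inv
    simpa only [Units.val_one, OneMemClass.coe_one, map_one] using this
  have h2 : Valued.v (((u⁻¹ : (padicAlgClIntegers p)ˣ) : padicAlgClIntegers p) : PadicAlgCl p) ≤ 1 :=
    (Valuation.mem_valuationSubring_iff _ _).mp (SetLike.coe_mem _)
  rw [hu'] at h1
  have h3 : Valued.v ((p : padicAlgClIntegers p) : PadicAlgCl p) *
      Valued.v (((u⁻¹ : (padicAlgClIntegers p)ˣ) : padicAlgClIntegers p) : PadicAlgCl p) < 1 * 1 :=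
    mul_lt_mul_of_lt_of_le_of_nonneg_of_pos hlt h2 zero_le zero_lt_one
  rw [h1, one_mul] at h3
  exact lt_irrefl _ h3

/-- In a field receiving the residue field of `ℤ̄_p` with `p` odd, `2 ≠ 0`. [folklore] -/
theorem two_ne_zero_of_residueField {p : ℕ} [Fact p.Prime] (hp2 : p ≠ 2) {k' : Type*} [Field k']
    (f : padicAlgClResidueField p →+* k') : (2 : k') ≠ 0 := by
  have hp : (p : ℕ).Prime := Fact.out
  have hpk : (p : k') = 0 := by
    have h := congrArg f (residue_natCast_eq_zero p)
    rwa [map_natCast, map_zero, map_natCast] at h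
  intro h2
  have hchar2 : ringChar k' ∣ 2 := (ringChar.spec k' 2).mp (by exact_mod_cast h2)
  have hcharp : ringChar k' ∣ p := (ringChar.spec k' p).mp (by exact_mod_cast hpk)
  have hne1 : ringChar k' ≠ 1 := by
    intro h1
    have h : ringChar k' ∣ 1 := by rw [h1]
    have h' : ((1 : ℕ) : k') = 0 := (ringChar.spec k' 1).mpr h
    exact one_ne_zero (by exact_mod_cast h')
  have h2' : ringChar k' = 2 := by
    rcases (Nat.dvd_prime Nat.prime_two).mp hchar2 with h | h
    · exact absurd h hne1
    · exact h
  rw [h2'] at hcharp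
  exact hp2 ((Nat.prime_dvd_prime_iff_eq Nat.prime_two hp).mp hcharp).symm

/-! ## A.3  Theorem A: residual absolute irreducibility from trace-zero-off-`H` + Hida frame -/

/-- **Theorem A (Galois level, Hecke-character-free).**  Let `g₁` be a newform of weight `2`
and level `N` with `p ∤ N`, `p` odd, `p`-ordinary for `ι : ℚ̄_p ≃ ℂ` (`v(ι⁻¹ a_p) = 1`), and
`ρ : Γ_ℚ → GL₂(ℚ̄_p)` an irreducible representation attached to `g₁`, unramified outside `Np`.
If the traces of `ρ` vanish off a proper subgroup `H ≤ Γ_ℚ` containing the image of the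
inertia group of `Γ_{ℚ_w}`, `w` the place above `p`, then some (hence every) reduction of `ρ`
is absolutely irreducible (`IsResiduallyAbsIrreducible`).  GRANTED: Hida's ordinary unit-root
frame `Hida2000_thm326_ordinary_unitRoot` (printed: H. Hida, *Modular Forms and Galois
Cohomology*, CUP 2000, Thm. 3.26 (2), p. 152); the inertia surjectivity of the cyclotomic
character is the tree theorem `adicCompletion_rat_exists_mem_absInertia_cyclotomicCharacter_eq`
(local Kronecker–Weber). [cite: Hida2000, Thm. 3.26 (2), p. 152] -/
theorem isResiduallyAbsIrreducible_of_trace_eq_zero_off_subgroup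
    (hW : Hida2000_thm326_ordinary_unitRoot) {N : ℕ} [NeZero N]
    (g₁ : CuspForm (CongruenceSubgroup.Gamma1 N) 2) (hg₁ : IsNewform1 g₁)
    (p : ℕ) [Fact p.Prime] (hp2 : p ≠ 2) (ι : PadicAlgCl p ≃+* ℂ) (hpN : ¬ p ∣ N)
    (hap : Valued.v (ι.symm ((UpperHalfPlane.qExpansion 1 ⇑g₁).coeff p)) = 1)
    (ρ : FramedGaloisRep ℚ (PadicAlgCl p) 2)
    (hρ : IsGaloisRepOfNewform1 g₁ ((ι.symm : ℂ →+* PadicAlgCl p).comp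
      (algebraMap (coeffCharField g₁) ℂ)) {q | q ∣ N * p} ρ)
    (hirr : ρ.toGaloisRep.IsIrreducible)
    (H : Subgroup (absoluteGaloisGroup ℚ)) (hH : ∃ γ₀, γ₀ ∉ H)
    (htr : ∀ γ, γ ∉ H →
      Matrix.trace ((ρ γ : GL (Fin 2) (PadicAlgCl p)) : Matrix (Fin 2) (Fin 2) (PadicAlgCl p)) = 0)
    (w : HeightOneSpectrum (𝓞 ℚ)) (hw : (p : 𝓞 ℚ) ∈ w.asIdeal)
    (hI : ∀ σ ∈ absInertia (w.adicCompletion ℚ), absGaloisRestrict ℚ (w.adicCompletion ℚ) σ ∈ H) :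
    ρ.IsResiduallyAbsIrreducible := by
  classical
  have hp : (p : ℕ).Prime := Fact.out
  obtain ⟨γ₀, hγ₀⟩ := hH
  -- an integral model and its reduction
  obtain ⟨P, ρ₀, hP⟩ := exists_integralModel_of_valuationSubring (O := padicAlgClIntegers p)
    (Valued.isOpen_valuationSubring _) ρ
  set τ₀ := integralReduction (RingHom.id (padicAlgClResidueField p)) ρ₀ with hτ₀def
  have hτ₀ : ρ.IsReductionOf (RingHom.id _) τ₀ :=
    ⟨ρ₀, 1, ⟨P, hP⟩, fun g => by rw [one_mul, inv_one, mul_one]⟩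
  refine ⟨τ₀, hτ₀, ?_⟩
  intro k' _ f
  -- the scalar extension `τ' = GL₂(f) ∘ τ₀` is again a reduction of `ρ`
  set τ' : absoluteGaloisGroup ℚ →* GL (Fin 2) k' := (Matrix.GeneralLinearGroup.map f).comp τ₀
    with hτ'def
  have hτ' : ρ.IsReductionOf f τ' := by
    refine ⟨ρ₀, 1, ⟨P, hP⟩, fun g => ?_⟩
    rw [one_mul, inv_one, mul_one, hτ'def, hτ₀def]
    ext i j
    rfl
  -- either no common eigenvector (done) or derive `2 = 0`
  by_contra hnot
  have hce : HasCommonEigenvector τ' := by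
    by_contra hce
    exact hnot (isIrreducible_of_not_hasCommonEigenvector τ' hce)
  -- traces of `τ'` vanish off `H` (they are reductions of the traces of `ρ`)
  have htr' : ∀ γ, γ ∉ H → Matrix.trace ((τ' γ : GL (Fin 2) k') : Matrix (Fin 2) (Fin 2) k') = 0 := by
    intro γ hγ
    obtain ⟨Pγ, hPF, hPk⟩ := hτ'.hasResidualCharpolys γ
    have hPF' : Pγ.map (padicAlgClIntegers p).subtype =
        ((ρ γ : GL (Fin 2) (PadicAlgCl p)) : Matrix (Fin 2) (Fin 2) (PadicAlgCl p)).charpoly := hPF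
    clear hPF
    have hPF := hPF'
    have hF := Matrix.trace_eq_neg_charpoly_coeff
      ((ρ γ : GL (Fin 2) (PadicAlgCl p)) : Matrix (Fin 2) (Fin 2) (PadicAlgCl p))
    have hk := Matrix.trace_eq_neg_charpoly_coeff ((τ' γ : GL (Fin 2) k') : Matrix (Fin 2) (Fin 2) k')
    rw [Fintype.card_fin] at hF hk
    norm_num at hF hk
    rw [htr γ hγ, ← hPF, Polynomial.coeff_map] at hF
    have h0 : Pγ.coeff 1 = 0 := by
      have : ((padicAlgClIntegers p).subtype (Pγ.coeff 1) : PadicAlgCl p) = 0 := by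
        rw [eq_comm, neg_eq_zero] at hF
        exact hF
      exact Subtype.ext this
    rw [hk, ← hPk, Polynomial.coeff_map, h0, map_zero, neg_zero]
  -- Hida's ordinary frame for the reduction `τ'`
  obtain ⟨Q, α, Qbar, a, δ, -, -, hfr⟩ :=
    hW.exists_residualFrame g₁ (by norm_num) hg₁ p ι hpN hap ρ hρ hirr w hw hτ'
  -- an inertia element with `ω(σ) = -1`
  have hv : ((Rat.HeightOneSpectrum.primesEquiv w : Nat.Primes) : ℕ) = p := by
    have h1 : Rat.HeightOneSpectrum.natGenerator w ∣ p := (Rat.natCast_mem_asIdeal_iff w).mp hw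
    exact (Nat.prime_dvd_prime_iff_eq (Rat.HeightOneSpectrum.primesEquiv w).2 hp).mp h1
  obtain ⟨σ, hσI, hσχ⟩ :=
    adicCompletion_rat_exists_mem_absInertia_cyclotomicCharacter_eq p w hv (-1)
  obtain ⟨-, ⟨-, h00, h11⟩, hinσ, -⟩ := hfr σ
  obtain ⟨hδ, ha⟩ := hinσ hσI
  -- `a σ = -1`, `δ σ = 1`, so the framed `τ'(σ)` has diagonal `(-1, 1)` and trace `0`
  have ha' : a σ = -1 := by
    apply Subtype.ext
    rw [ha, hσχ, show ((2 : ℤ) - 1) = 1 by norm_num, zpow_one, Units.val_neg, Units.val_one,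
      PadicInt.coe_neg, PadicInt.coe_one, map_neg, map_one]
    rfl
  rw [ha', map_neg, map_one, map_neg, map_one] at h00
  rw [hδ, map_one, map_one] at h11
  have hγtr : Matrix.trace ((τ' (absGaloisRestrict ℚ (w.adicCompletion ℚ) σ) : GL (Fin 2) k') :
      Matrix (Fin 2) (Fin 2) k') = 0 := by
    rw [← trace_conj_eq Qbar, Matrix.trace_fin_two]
    change (Qbar⁻¹ * τ' (absGaloisRestrict ℚ (w.adicCompletion ℚ) σ) * Qbar).val 0 0 +
      (Qbar⁻¹ * τ' (absGaloisRestrict ℚ (w.adicCompletion ℚ) σ) * Qbar).val 1 1 = 0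
    rw [h00, h11]; ring
  exact two_ne_zero_of_residueField hp2 f
    (two_eq_zero_of_trace_eq_zero_off_subgroup τ' H hγ₀ htr' hce (hI σ hσI) hγtr)

end Summit.BirchSwinnertonDyer.BirchSwinnertonDyer.Theorems.ErratumRoadFiveBdvCalibrationSplitNFCalibratorSupply
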